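import Summits.ResolutionOfSingularities.ResolutionOfSingularities.Theorems.EquisingularLiftEquisingularLiftNatConeRoundTransport
import Literature.AlgebraicGeometry.Resolution.BlowupRestrictOpen
import Literature.AlgebraicGeometry.Resolution.NormalCrossingsLocal
import HarnessLib

/-!
# [OURS · L1 W4.5(b) · EL♮(3)] rung TOWER₄ supplier — THE RESTRICTED T2: the special-fibre trace of a strict transform through a cone round when
# the shadow trace is only known ON AN OPEN `V` (clause (k-ii-loc) of res-D-pv-029's `Tower.Shadow₃`, …NatTowerInvDefs v3 p570397)

Crux chain w45b (cell `res-hironaka`, slot W4.5(b)), working crux **EL♮** = stmt-ResolutionOfSingularities-20038, child **EL♮(3)** =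
stmt-ResolutionOfSingularities-20148, route EquisingularLift, line `sections`; registered stub `stub_elnat_coneTowerPointResolution` @ `ReachTower₄`.
Written by res-L1-w45b-stub-4 g8 on res-D-pv-029's retarget list (STATUS 2026-08-27T20:58:53Z «pv-051: a RESTRICTED `coneRound_shadow_comap`»;
desk NO OBJECTION to stub-4 taking it, 21:38:03Z). HONEST FRAMING: OURS; NOT a statement of any manuscript; AI-written, weaker than expert review.
No `sorry`; standard axioms; DEF-FREE. `--supports stmt-ResolutionOfSingularities-20148 --as helper`.

WHAT. res-D-pv-051's T2/T3 (`comap_eq_vanishingIdeal_closure_of_iso_over`, …NatConeRoundTransport p549332): in a cartesian model square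
`j' ≫ τ = υ ≫ j` with an isomorphism `V(I') ≅ V(I)` over `τ`, `I·𝒪_G = 𝓘⟨K̄⟩`, `υ` the blow-up of `𝓘⟨Z⟩`, `Z` nowhere dense in `K̄`:
`I'·𝒪_{G'} = 𝓘⟨closure υ⁻¹(K̄ ∖ Z)⟩`. HERE the trace hypothesis is only LOCAL — `(I·𝒪_G)|_V = 𝓘⟨K̄⟩|_V` on an open `V ⊆ G` — and so is the
conclusion: `(I'·𝒪_{G'})|_{υ⁻¹V} = 𝓘⟨closure υ⁻¹(K̄ ∖ Z)⟩|_{υ⁻¹V}` (`comap_comap_ι_eq_vanishingIdeal_closure_of_iso_over_loc`), with density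
asked only on `V` (`K̄ ∩ V ⊆ closure (K̄ ∖ Z)`). PROOF: apply the global lemma to the RESTRICTED cartesian square
`(υ⁻¹V ↪ G' → X', υ ∣_ V, τ, V ↪ G → X)` (`isPullback_morphismRestrict` pasted onto the model square), where the trace IS global
(`comap_vanishingIdeal_of_isOpenImmersion`), the restricted blow-up is a blow-up (`IsBlowup.morphismRestrict`), density restricts along the
open embedding, and closures in `υ⁻¹V` are preimages of closures (`IsOpenMap.preimage_closure_eq_closure_preimage`).
COROLLARY `coneRound_shadow_comap_loc`: through a cone round (`τ` the blow-up of `𝓔 ⊔ 𝒦`, `𝓔|_{V(𝒦)}` Cartier, so `V(St 𝒦) ≅ V(𝒦)`):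
`((St 𝒦)·𝒪_{G'})|_{υ⁻¹V} = 𝓘⟨closure υ⁻¹(K̄ ∖ Z)⟩|_{υ⁻¹V}` — the (k-ii-loc) clause of the NEW shadow after a cone round, and (with
`exists_iso_subscheme_strictTransformIdeal_exceptional`) `coneRound_exceptional_comap_loc` for the old exceptional surface.

References (index only): res-D-pv-051 …NatConeRoundTransport p549332 / …NatConeRoundCartier p545368; res-D-pv-029 …NatTowerInvDefs v3 p570397;
Literature `BlowupRestrictOpen` (`IsBlowup.morphismRestrict`), `NormalCrossingsLocal` (`comap_vanishingIdeal_of_isOpenImmersion`).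
[cite: GortzWedhorn2020, Prop. 13.91 and (13.19)]
-/

set_option linter.dupNamespace false -- mandated namespace `Summit.<Summit>.<Problem>` of this single-conjunct summit

noncomputable section

open CategoryTheory CategoryTheory.Limits AlgebraicGeometry TopologicalSpace Topology
open Literature.AlgebraicGeometry.Resolution
open AlgebraicGeometry.Scheme.IdealSheafData

namespace Summit.ResolutionOfSingularities.ResolutionOfSingularities.Cruxes.EquisingularLiftNat.Sections

section FibreIsoLoc

variable {X X' G G' : Scheme.{0}} {τ : X' ⟶ X} {j : G ⟶ X} {j' : G' ⟶ X'} {υ : G' ⟶ G}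

/-- Closures inside an open subscheme are traces of closures: for `V' : G'.Opens` and `A ⊆ G'`,
`closure (V'.ι ⁻¹' A) = V'.ι ⁻¹' closure A`. [folklore] -/
theorem closure_preimage_ι_eq (V' : G'.Opens) (A : Set G') :
    closure ((V'.ι : _ → G') ⁻¹' A) = (V'.ι : _ → G') ⁻¹' closure A :=
  (V'.ι.isOpenEmbedding.isOpenMap.preimage_closure_eq_closure_preimage V'.ι.continuous A).symm

/-- **THE RESTRICTED T2/T3** (see the module docstring): local trace in, local trace out.
[cite: GortzWedhorn2020, Prop. 13.91 and (13.19)] [OURS · L1 W4.5b · restriction of res-D-pv-051's `comap_eq_vanishingIdeal_closure_of_iso_over`]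
toward `stub_elnat_coneTowerPointResolution` (stmt-ResolutionOfSingularities-20148); NOT a statement of the manuscript. -/
theorem comap_comap_ι_eq_vanishingIdeal_closure_of_iso_over_loc (hsq : IsPullback j' υ τ j) (I' : X'.IdealSheafData)
    (I : X.IdealSheafData) (e : I'.subscheme ≅ I.subscheme) (he : e.hom ≫ I.subschemeι = I'.subschemeι ≫ τ) (Kc Zc : Closeds G)
    (V : G.Opens) (hI : (I.comap j).comap V.ι = (vanishingIdeal Kc).comap V.ι) (hυ : IsBlowup υ (vanishingIdeal Zc))
    (hdense : (Kc : Set G) ∩ (V : Set G) ⊆ closure ((Kc : Set G) \ Zc)) :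
    (I'.comap j').comap (υ ⁻¹ᵁ V).ι =
      (vanishingIdeal (⟨closure (υ ⁻¹' ((Kc : Set G) \ Zc)), isClosed_closure⟩ : Closeds G')).comap (υ ⁻¹ᵁ V).ι := by
  -- the restricted cartesian square `(υ⁻¹V).ι ≫ j'`, `υ ∣_ V`, `τ`, `V.ι ≫ j`
  have hsqV : IsPullback ((υ ⁻¹ᵁ V).ι ≫ j') (υ ∣_ V) τ (V.ι ≫ j) :=
    (isPullback_morphismRestrict υ V).flip.paste_horiz hsq
  -- the restricted data: global trace on `V`, blow-up of `Z ∩ V`, density in `V`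
  have hIV : I.comap (V.ι ≫ j) = vanishingIdeal (Kc.preimage V.ι.continuous) := by
    rw [Scheme.IdealSheafData.comap_comp, hI, comap_vanishingIdeal_of_isOpenImmersion]
  have hυV : IsBlowup (υ ∣_ V) (vanishingIdeal (Zc.preimage V.ι.continuous)) := by
    have h := hυ.morphismRestrict (U := V)
    rwa [comap_vanishingIdeal_of_isOpenImmersion] at h
  have hdenseV : ((Kc.preimage V.ι.continuous : Closeds V) : Set V) ⊆
      closure (((Kc.preimage V.ι.continuous : Closeds V) : Set V) \ (Zc.preimage V.ι.continuous : Closeds V)) := by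
    intro v hv
    rw [Closeds.coe_preimage, Set.mem_preimage] at hv
    have h1 : (V.ι : _ → G) v ∈ closure ((Kc : Set G) \ Zc) := hdense ⟨hv, by rw [Scheme.Opens.ι_apply]; exact v.2⟩
    have h2 := V.ι.isOpenEmbedding.isOpenMap.preimage_closure_subset_closure_preimage (s := (Kc : Set G) \ Zc) h1
    refine closure_mono ?_ h2
    intro w hw
    exact hw
  -- the global lemma on the restricted square
  have h := comap_eq_vanishingIdeal_closure_of_iso_over hsqV I' I e he _ _ hIV hυV hdenseV
  rw [Scheme.IdealSheafData.comap_comp] at h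
  rw [h, comap_vanishingIdeal_of_isOpenImmersion]
  congr 1
  apply Closeds.ext
  rw [Closeds.coe_preimage]
  change closure ((υ ∣_ V) ⁻¹' (((V.ι : _ → G)) ⁻¹' (Kc : Set G) \ (V.ι : _ → G) ⁻¹' (Zc : Set G))) =
    ((υ ⁻¹ᵁ V).ι : _ → G') ⁻¹' closure (υ ⁻¹' ((Kc : Set G) \ Zc))
  rw [← closure_preimage_ι_eq]
  congr 1
  ext w
  simp only [Set.mem_preimage, Set.mem_sdiff]
  rw [show (V.ι : _ → G) ((υ ∣_ V) w) = υ (((υ ⁻¹ᵁ V).ι : _ → G') w) from by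
    rw [Scheme.Opens.ι_apply, Scheme.Opens.ι_apply, morphismRestrict_base_coe]]

end FibreIsoLoc

/-! ## Through the cone round -/

section ConeRoundLoc

variable {X X' G G' : Scheme.{0}} [IsLocallyNoetherian X] (𝓔 𝒦 : X.IdealSheafData) {τ : X' ⟶ X} {j : G ⟶ X}
  {j' : G' ⟶ X'} {υ : G' ⟶ G}

/-- **CONE ROUND, (k-ii-loc) FOR THE NEW SHADOW: `((St 𝒦)·𝒪_{G'})|_{υ⁻¹V} = 𝓘⟨closure υ⁻¹(K̄ ∖ Z)⟩|_{υ⁻¹V}`** when the old shadow trace is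
known on `V` only. [cite: GortzWedhorn2020, Prop. 13.91 and (13.19)] [OURS · L1 W4.5b · restriction of res-D-pv-051's `coneRound_shadow_comap`]
toward `stub_elnat_coneTowerPointResolution` (stmt-ResolutionOfSingularities-20148); NOT a statement of the manuscript. -/
theorem coneRound_shadow_comap_loc (hE𝒦 : IsEffectiveCartier (𝓔.comap 𝒦.subschemeι)) (hτ : IsBlowup τ (𝓔 ⊔ 𝒦))
    (hsq : IsPullback j' υ τ j) (Kc Zc : Closeds G) (V : G.Opens)
    (hK : (𝒦.comap j).comap V.ι = (vanishingIdeal Kc).comap V.ι) (hυ : IsBlowup υ (vanishingIdeal Zc))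
    (hdense : (Kc : Set G) ∩ (V : Set G) ⊆ closure ((Kc : Set G) \ Zc)) :
    ((strictTransformIdeal τ (𝓔 ⊔ 𝒦) 𝒦).comap j').comap (υ ⁻¹ᵁ V).ι =
      (vanishingIdeal (⟨closure (υ ⁻¹' ((Kc : Set G) \ Zc)), isClosed_closure⟩ : Closeds G')).comap (υ ⁻¹ᵁ V).ι := by
  obtain ⟨e, he⟩ := nonempty_iso_subscheme_strictTransformIdeal_cone 𝓔 𝒦 hE𝒦 hτ
  exact comap_comap_ι_eq_vanishingIdeal_closure_of_iso_over_loc hsq _ _ e he Kc Zc V hK hυ hdense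

/-- **CONE ROUND, THE OLD EXCEPTIONAL SURFACE, restricted form: `((St 𝓔)·𝒪_{G'})|_{υ⁻¹V} = 𝓘⟨closure υ⁻¹(E ∖ Z)⟩|_{υ⁻¹V}`** when
`(𝓔·𝒪_G)|_V = 𝓘⟨E⟩|_V` (with `𝒦|_{V(𝓔)}` Cartier). [cite: GortzWedhorn2020, Prop. 13.91 and (13.19)] [OURS · L1 W4.5b]; NOT a statement of the
manuscript. -/
theorem coneRound_exceptional_comap_loc (hK𝓔 : IsEffectiveCartier (𝒦.comap 𝓔.subschemeι)) (hτ : IsBlowup τ (𝓔 ⊔ 𝒦))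
    (hsq : IsPullback j' υ τ j) (Ec Zc : Closeds G) (V : G.Opens)
    (hE : (𝓔.comap j).comap V.ι = (vanishingIdeal Ec).comap V.ι) (hυ : IsBlowup υ (vanishingIdeal Zc))
    (hdense : (Ec : Set G) ∩ (V : Set G) ⊆ closure ((Ec : Set G) \ Zc)) :
    ((strictTransformIdeal τ (𝓔 ⊔ 𝒦) 𝓔).comap j').comap (υ ⁻¹ᵁ V).ι =
      (vanishingIdeal (⟨closure (υ ⁻¹' ((Ec : Set G) \ Zc)), isClosed_closure⟩ : Closeds G')).comap (υ ⁻¹ᵁ V).ι := by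
  obtain ⟨e, he⟩ := exists_iso_subscheme_strictTransformIdeal_exceptional 𝓔 𝒦 hK𝓔 hτ
  exact comap_comap_ι_eq_vanishingIdeal_closure_of_iso_over_loc hsq _ _ e he Ec Zc V hE hυ hdense

end ConeRoundLoc

end Summit.ResolutionOfSingularities.ResolutionOfSingularities.Cruxes.EquisingularLiftNat.Sections

end
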